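import Literature.MathematicalPhysics.QuantumLattice.PeriodicVariationalEquilibria
import HarnessLib

/-!
# Superlattice refinement: the periodic pressure and the periodic equilibria do not depend on the period

For a `q`-periodic interaction `Ψ` (Hermitian, even, finite range, `d ≥ 1`) and every COARSER superlattice `q'`
(`(q_i+1) ∣ (q'_i+1)`, i.e. `L_{q'} ⊆ L_q`):

* §1 refinement: `q`-periodic states / interactions are `q'`-periodic (`IsPeriodic.of_dvd`), superlattice vectors of `L_{q'}` are
  superlattice vectors of `L_q`.
* §2 the cell energy density is intrinsic: `ē_{q'}(Ψ)(ω) = ē_q(Ψ)(ω)` for `q`-periodic data (`IsPeriodic.cellMeanEnergy_eq_of_dvd`, through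
  the aligned-box identity `Σ_{x∈[0,n)^d} Re ε(x) = n^d ē` with `n = Π(q'_i+1)`), hence the unconditional monotonicity `P_q ≤ P_{q'}`.
* §3 **THE PERIODIC PRESSURE IS SUPERLATTICE-INDEPENDENT**: `P_{q'}(β,Ψ) = P_q(β,Ψ)` for every real `β` (`perVarPressure_eq_of_dvd`) — both are
  the limit of `N^{-d} log Re Z_{[0,N)^d}` along boxes aligned with `L_{q'}` (`tendsto_boxLogPartitionFn_perVarPressure`). Allowing LONGER periods
  in the trial states never raises the pressure; symmetry breaking can only enlarge the SET of maximisers.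
* §4 equilibria: a `q`-periodic equilibrium state is a `q'`-periodic equilibrium state (`IsPerVarEquilibrium.of_dvd`); for a translation-covariant
  `Ψ`, translation-invariant equilibrium states (`IsVarEquilibrium`) are `q`-periodic equilibrium states for every `q`
  (`IsVarEquilibrium.isPerVarEquilibrium`), and the cell average of a `q`-periodic equilibrium state is a translation-invariant equilibrium
  state (`IsPerVarEquilibrium.cellAverage_isVarEquilibrium`) — so the Griffiths windows of `PeriodicVariationalEquilibria` for cell-averaged
  observables (staggered magnetisation, sublattice densities) constrain EVERY periodic equilibrium state of a translation-covariant model,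
  whatever its period.

Everything is PROVED; no definition, no named fact, no number. HONEST SCOPE: nothing is said about `q'`-periodic equilibria that are
not `q`-periodic beyond their cell averages (no uniqueness, no symmetry-breaking claim either way).

## Tree / Mathlib search

REUSED: `InfVolFermionState.IsPeriodic`, `periodVec`, `cellAverage`, `IsPeriodic.isTranslationInvariant_cellAverage` (`PeriodicStatesCellAverage`);
`superlatVec`, `FermionInteraction.IsPeriodic`, `IsPeriodic.shift_superlatVec`, `cellMeanEnergy`, `IsPeriodic.sum_re_siteEnergy_halfOpenBox_eq`,
`cellMeanEnergy_eq_meanEnergy_cellAverage`, `IsTranslationInvariant.cellMeanEnergy_eq` (`PeriodicInteractionsCellEnergy`); `perVarPressure`,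
`sub_mul_le_perVarPressure`, `perVarPressure_le`, `dvd_prod_succ`, `IsPeriodic.entropyDensitySup_le_cellAverage`, `perVarPressure_eq_varPressure`
(`PeriodicVariationalPressure`); `tendsto_boxLogPartitionFn_perVarPressure` (`PeriodicGibbsVariationalPrinciple`); `IsPerVarEquilibrium`
(`PeriodicVariationalEquilibria`); `IsVarEquilibrium`, `sub_mul_le_varPressure` (`TIVariationalPressure`); Mathlib `Finset.prod_dvd_prod_of_dvd`,
`tendsto_nhds_unique`. `lean search 'perVarPressure dvd|IsPeriodic.of_dvd|superlattice refinement'` (2026-08-28): no hits.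

## References

* R. B. Israel, *Convexity in the Theory of Lattice Gases* (1979), §I.1 (periodic interactions via the sublattice), Thm. I.2.4, Thm. II.3.2.
* H. Araki, H. Moriya, Rev. Math. Phys. 15 (2003) 93, §4.1 (periodic states), §8, §11–§12.
-/

noncomputable section

open scoped ComplexOrder BigOperators
open Finset Filter Topology

namespace Literature.MathematicalPhysics.QuantumLattice

open Matrix HubbardWave0 Literature.Probability.LatticeModels ThermodynamicLimit

variable {d : ℕ} {q q' : Fin d → ℕ}

/-! ### §1. Refinement of the superlattice -/

/-- The quotient of the periods is a positive integer multiplier: `((q'_i+1)/(q_i+1))·(q_i+1) = q'_i+1` (in `ℤ`). [cite: ArakiMoriya2003, §4.1] -/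
theorem natCast_div_mul_eq_of_dvd (hqq' : ∀ i, (q i + 1) ∣ (q' i + 1)) (i : Fin d) :
    (((q' i + 1) / (q i + 1) : ℕ) : ℤ) * ((q i : ℤ) + 1) = (q' i : ℤ) + 1 := by
  have h := Nat.div_mul_cancel (hqq' i)
  exact_mod_cast h

/-- The periods of the coarser superlattice are superlattice vectors of the finer one. [cite: ArakiMoriya2003, §4.1] -/
theorem periodVec_eq_superlatVec_of_dvd (hqq' : ∀ i, (q i + 1) ∣ (q' i + 1)) (i : Fin d) :
    periodVec q' i = superlatVec q (Pi.single i (((q' i + 1) / (q i + 1) : ℕ) : ℤ)) := by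
  funext j
  rw [periodVec, superlatVec_apply]
  by_cases hj : j = i
  · subst hj
    rw [Pi.single_eq_same, Pi.single_eq_same, natCast_div_mul_eq_of_dvd hqq']
  · rw [Pi.single_eq_of_ne hj, Pi.single_eq_of_ne hj, zero_mul]

/-- Superlattice vectors of `L_{q'}` are superlattice vectors of `L_q`. [cite: ArakiMoriya2003, §4.1] -/
theorem superlatVec_eq_superlatVec_of_dvd (hqq' : ∀ i, (q i + 1) ∣ (q' i + 1)) (z : Fin d → ℤ) :
    superlatVec q' z = superlatVec q (fun i => z i * (((q' i + 1) / (q i + 1) : ℕ) : ℤ)) := by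
  funext i
  rw [superlatVec_apply, superlatVec_apply, mul_assoc, natCast_div_mul_eq_of_dvd hqq']

/-- **A `q`-periodic state is `q'`-periodic for every coarser `q'`.** [cite: ArakiMoriya2003, §4.1 Def. 4.5] -/
theorem InfVolFermionState.IsPeriodic.of_dvd {ω : InfVolFermionState d} (hω : ω.IsPeriodic q)
    (hqq' : ∀ i, (q i + 1) ∣ (q' i + 1)) : ω.IsPeriodic q' := fun i => by
  rw [periodVec_eq_superlatVec_of_dvd hqq' i]
  exact hω.shift_superlatVec _

/-- **A `q`-periodic interaction is `q'`-periodic for every coarser `q'`.** [cite: ArakiMoriya2003, §1 assumption (IV) and §8] -/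
theorem FermionInteraction.IsPeriodic.of_dvd {Ψ : FermionInteraction d} (hΨ : Ψ.IsPeriodic q)
    (hqq' : ∀ i, (q i + 1) ∣ (q' i + 1)) : Ψ.IsPeriodic q' := fun z X => by
  rw [superlatVec_eq_superlatVec_of_dvd hqq' z]
  exact hΨ _ X

/-! ### §2. The cell energy density is intrinsic -/

namespace InfVolFermionState

variable {Ψ : FermionInteraction d} {ω : InfVolFermionState d}

/-- **The cell energy density of `q`-periodic data does not depend on the (coarser) superlattice used to compute it**:
`ē_{q'}(Ψ)(ω) = ē_q(Ψ)(ω)`. [cite: ArakiMoriya2003, §4.1 Def. 4.5] [cite: Israel1979, Thm. I.2.4] -/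
theorem IsPeriodic.cellMeanEnergy_eq_of_dvd (hω : ω.IsPeriodic q) (hΨ : Ψ.IsPeriodic q) (hqq' : ∀ i, (q i + 1) ∣ (q' i + 1)) (R : ℝ) :
    cellMeanEnergy q' Ψ ω R = cellMeanEnergy q Ψ ω R := by
  have hn' : ∀ i, (q' i + 1) ∣ ∏ j, (q' j + 1) := dvd_prod_succ q'
  have hnq : ∀ i, (q i + 1) ∣ ∏ j, (q' j + 1) := fun i => (hqq' i).trans (hn' i)
  have h1 := (hω.of_dvd hqq').sum_re_siteEnergy_halfOpenBox_eq (hΨ.of_dvd hqq') R hn'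
  have h2 := hω.sum_re_siteEnergy_halfOpenBox_eq hΨ R hnq
  have hL1 : 1 ≤ ∏ j, (q' j + 1) := Finset.prod_pos fun j _ => Nat.succ_pos _
  have hpos : (0 : ℝ) < ((∏ j, (q' j + 1) : ℕ) : ℝ) ^ d := by positivity
  exact mul_left_cancel₀ hpos.ne' (h1.symm.trans h2)

end InfVolFermionState

namespace FermionInteraction

variable {Ψ : FermionInteraction d} {R : ℝ}

/-- **Monotonicity** (unconditional): `P_q ≤ P_{q'}` for `q`-periodic `Ψ` and coarser `q'` (more trial states, the same functional).
[cite: Israel1979, Thm. I.2.4] -/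
theorem perVarPressure_le_of_dvd (hΨ : Ψ.IsPeriodic q) (hqq' : ∀ i, (q i + 1) ∣ (q' i + 1)) (β R : ℝ) :
    Ψ.perVarPressure β q R ≤ Ψ.perVarPressure β q' R :=
  Ψ.perVarPressure_le β q R fun ω hω => by
    rw [← hω.cellMeanEnergy_eq_of_dvd hΨ hqq' R]
    exact Ψ.sub_mul_le_perVarPressure β q' R (hω.of_dvd hqq')

/-! ### §3. The periodic pressure is superlattice-independent -/

/-- **`P_{q'}(β,Ψ) = P_q(β,Ψ)`** for a `q`-periodic Hermitian even finite-range `Ψ` and every coarser `q'` (`d ≥ 1`, every real `β`): both are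
the limit of the aligned box pressures. [cite: Israel1979, Thm. I.2.4] [cite: BratteliRobinsonII1997, Thm. 6.2.40] -/
theorem perVarPressure_eq_of_dvd (hd : 0 < d) (hH : Ψ.IsHermitian) (hE : Ψ.IsEven) (hΨ : Ψ.IsPeriodic q) (hR : Ψ.HasFiniteRange R)
    (hqq' : ∀ i, (q i + 1) ∣ (q' i + 1)) (β : ℝ) : Ψ.perVarPressure β q' R = Ψ.perVarPressure β q R := by
  obtain ⟨m, hm⟩ : (∏ i, (q i + 1)) ∣ ∏ i, (q' i + 1) := Finset.prod_dvd_prod_of_dvd _ _ fun i _ => hqq' i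
  have hL1 : 1 ≤ ∏ i, (q i + 1) := Finset.prod_pos fun j _ => Nat.succ_pos _
  have hL'1 : 1 ≤ ∏ i, (q' i + 1) := Finset.prod_pos fun j _ => Nat.succ_pos _
  have hm1 : 1 ≤ m := by
    rcases Nat.eq_zero_or_pos m with h0 | h0
    · rw [h0, mul_zero] at hm
      omega
    · exact h0
  have h1 := tendsto_boxLogPartitionFn_perVarPressure hd hH hE (hΨ.of_dvd hqq') hR β
  have h2 := tendsto_boxLogPartitionFn_perVarPressure hd hH hE hΨ hR β
  rw [hm] at h1
  have hkm : Tendsto (fun k : ℕ => k * m) atTop atTop := tendsto_atTop_mono (fun k => Nat.le_mul_of_pos_right k hm1) tendsto_id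
  have h3 : Tendsto (fun k : ℕ => Real.log (Matrix.partitionFn β (Ψ.localHamiltonian (halfOpenBox d (k * m * ∏ i, (q i + 1))))).re /
      (((k * m * ∏ i, (q i + 1) : ℕ) : ℝ) ^ d)) atTop (𝓝 (Ψ.perVarPressure β q R)) := h2.comp hkm
  have heq : (fun k : ℕ => Real.log (Matrix.partitionFn β (Ψ.localHamiltonian (halfOpenBox d (k * ((∏ i, (q i + 1)) * m))))).re /
      (((k * ((∏ i, (q i + 1)) * m) : ℕ) : ℝ) ^ d)) =
      fun k : ℕ => Real.log (Matrix.partitionFn β (Ψ.localHamiltonian (halfOpenBox d (k * m * ∏ i, (q i + 1))))).re /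
        (((k * m * ∏ i, (q i + 1) : ℕ) : ℝ) ^ d) := by
    funext k
    rw [show k * ((∏ i, (q i + 1)) * m) = k * m * ∏ i, (q i + 1) by ring]
  rw [heq] at h1
  exact tendsto_nhds_unique h1 h3

/-- In particular `P_q(β,Ψ) = P_0(β,Ψ)`-style collapse for translation-covariant `Ψ` is `perVarPressure_eq_varPressure`; here the version between
two superlattices both dividing a third: `P_{q₁} = P_{q₂}` whenever `Ψ` is periodic for both and `q₁, q₂ ∣ q'`. [cite: Israel1979, Thm. I.2.4] -/
theorem perVarPressure_eq_of_dvd_of_dvd (hd : 0 < d) (hH : Ψ.IsHermitian) (hE : Ψ.IsEven) {q₁ q₂ : Fin d → ℕ} (h₁ : Ψ.IsPeriodic q₁)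
    (h₂ : Ψ.IsPeriodic q₂) (hR : Ψ.HasFiniteRange R) (h₁' : ∀ i, (q₁ i + 1) ∣ (q' i + 1)) (h₂' : ∀ i, (q₂ i + 1) ∣ (q' i + 1)) (β : ℝ) :
    Ψ.perVarPressure β q₁ R = Ψ.perVarPressure β q₂ R := by
  rw [← perVarPressure_eq_of_dvd hd hH hE h₁ hR h₁' β, perVarPressure_eq_of_dvd hd hH hE h₂ hR h₂' β]

end FermionInteraction

/-! ### §4. Equilibria under refinement; translation-invariant versus periodic equilibria -/

namespace InfVolFermionState

variable {Ψ : FermionInteraction d} {R β : ℝ} {ω : InfVolFermionState d}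

/-- **A `q`-periodic equilibrium state is a `q'`-periodic equilibrium state** for every coarser `q'`. [cite: Israel1979, Thm. II.3.2] -/
theorem IsPerVarEquilibrium.of_dvd (hd : 0 < d) (hH : Ψ.IsHermitian) (hE : Ψ.IsEven) (hΨ : Ψ.IsPeriodic q) (hR : Ψ.HasFiniteRange R)
    (hqq' : ∀ i, (q i + 1) ∣ (q' i + 1)) (h : ω.IsPerVarEquilibrium β q Ψ R) : ω.IsPerVarEquilibrium β q' Ψ R := by
  refine ⟨h.1.of_dvd hqq', ?_⟩
  rw [h.1.cellMeanEnergy_eq_of_dvd hΨ hqq' R, Ψ.perVarPressure_eq_of_dvd hd hH hE hΨ hR hqq' β]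
  exact h.2

/-- **Translation-invariant equilibrium states are `q`-periodic equilibrium states** (translation-covariant `Ψ`, every `q`, `d ≥ 1`).
[cite: Israel1979, Thm. II.3.2] [cite: ArakiMoriya2003, Theorem 12.11] -/
theorem IsVarEquilibrium.isPerVarEquilibrium (hd : 0 < d) (hT : Ψ.IsTranslationInvariant) (h : ω.IsVarEquilibrium β Ψ R)
    (q : Fin d → ℕ) : ω.IsPerVarEquilibrium β q Ψ R := by
  refine ⟨h.1.isPeriodic q, ?_⟩
  rw [h.1.cellMeanEnergy_eq hT, FermionInteraction.perVarPressure_eq_varPressure hd β q hT R]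
  exact h.2

/-- **The cell average of a periodic equilibrium state is a translation-invariant equilibrium state** (translation-covariant `Ψ`): it is
translation invariant, has the same energy density and not smaller mean entropy, and `P_q = P`. [cite: Israel1979, Thm. II.3.2] [cite: ArakiMoriya2003, Theorem 12.11] -/
theorem IsPerVarEquilibrium.cellAverage_isVarEquilibrium (hd : 0 < d) (hT : Ψ.IsTranslationInvariant)
    (h : ω.IsPerVarEquilibrium β q Ψ R) : (ω.cellAverage q).IsVarEquilibrium β Ψ R := by
  have hTI := h.1.isTranslationInvariant_cellAverage
  refine ⟨hTI, le_antisymm (Ψ.sub_mul_le_varPressure β R hTI) ?_⟩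
  rw [← FermionInteraction.perVarPressure_eq_varPressure hd β q hT R, ← h.2, ← cellMeanEnergy_eq_meanEnergy_cellAverage hT]
  have hs := h.1.entropyDensitySup_le_cellAverage hd
  rcases le_or_gt 0 β with hb | hb <;> nlinarith [hs]

/-- … and it has the SAME mean entropy: a periodic equilibrium state of a translation-covariant model loses no entropy under cell
averaging (`s̄(ω) = s̄(ω̄)`). [cite: ArakiMoriya2003, Theorem 12.11] -/
theorem IsPerVarEquilibrium.entropyDensitySup_cellAverage_eq (hd : 0 < d) (hT : Ψ.IsTranslationInvariant)
    (h : ω.IsPerVarEquilibrium β q Ψ R) : (ω.cellAverage q).entropyDensitySup = ω.entropyDensitySup := by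
  have hTI := h.1.isTranslationInvariant_cellAverage
  have hup := Ψ.sub_mul_le_varPressure β R hTI
  rw [← FermionInteraction.perVarPressure_eq_varPressure hd β q hT R, ← h.2, ← cellMeanEnergy_eq_meanEnergy_cellAverage hT] at hup
  have hs := h.1.entropyDensitySup_le_cellAverage hd
  linarith

end InfVolFermionState

end Literature.MathematicalPhysics.QuantumLattice

end
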